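import Summits.AtomisticToContinuum.BoseEinsteinCondensation.Theorems.BECGroundStateSOSLatticeODLROOffHalfFillingOfConcave
import Summits.AtomisticToContinuum.BoseEinsteinCondensation.Theorems.BECGroundStateSOSLatticeODLROOffHalfFillingGroundSectorUnique
import Literature.MathematicalPhysics.QuantumLattice.XYOrderInfraredHolds

/-!
# Crux `LatticeODLROOffHalfFilling` — the ladder line: the quantitative KLS anchor and the weakest shape reduction
# (Casimir monotonicity ⇒ ODLRO off half filling, modulo the certified Riemann-sum bound)

Route BECGroundStateSOS, crux stmt-AtomisticToContinuum-11033, line `Sketch` (gen-1 lead). Supports the crux.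

* `lroSeq_zero_eventually_ge` — the Kennedy–Lieb–Shastry theorem QUANTITATIVELY at `μ = 0`, `d = 3`, `S = ½`: if the
  punctured Riemann sums of the KLS integrand satisfy `R_L(3) ≤ ρ` eventually (`0 ≤ ρ < 1/√2`), then the `k`-th term of
  the crux's order parameter at `μ = 0` is eventually `≥ ¼ − (√2/4)ρ` (the constant `2(s − ½√s ρ)`, `s = S²/2 = ⅛`, of
  `kennedy_lieb_shastry_xy_ground_of_riemannSum_le`, whose proof is followed verbatim); `anchor_of_riemannSum_le` is
  its column form (pigeonhole `exists_col_quad_ge`). The tree's bound `R_L(3) ≤ 0.69` gives only `0.006`; the true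
  limit is `I(3) = 0.3499` (kit j009618), which would give `0.126`.
* `sector_window_tenth` — for `|μ| ≤ 1/10` every `S³_tot`-eigen ground vector of `H_{L,μ}` has `|M| ≤ (15/58)L³`
  (same Rayleigh argument as `sector_window`).
* `LatticeODLROOffHalfFilling_of_casimir` — **the weakest ladder-shape reduction**: CASIMIR MONOTONICITY
  (`⟨S_tot²⟩_ψ ≥ ⟨S_tot²⟩_{ψh}` for sector ground vectors `ψ` against the half-filled one, i.e. `a(ψh) ≤ a(ψ) + M²`)
  together with the certified-numerics input `R_L(3) ≤ ½` eventually imply the crux with `μ₀ = 1/10`: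
  `a(ψ) ≥ a(ψh) − M² ≥ (¼ − √2/8 − (15/58)²)L⁶ > 0.006·L⁶`, the half-filled anchor being `groundSector_zero`
  (GroundSectorUnique). Casimir monotonicity is implied by MONO (the line's registered K1) and is the weakest member of
  the family {Concave, MONO, C_S}; like them it holds on every torus computed and fails on generic graphs (kit
  j016215/j016375, evidence `mono-evidence.md`), so it is crux-sized — this file records exactly what it buys and names
  the computational debt (`klsRiemannSum 3 L ≤ ½` for large `L`, shared with the certificate line's slack budget).
-/

noncomputable section

namespace Summit.AtomisticToContinuum.BoseEinsteinCondensation.Theorems.LatticeODLROOffHalfFilling.Ladder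

open Literature.MathematicalPhysics.QuantumLattice Literature.Probability.LatticeModels Matrix Finset Filter
open Summit.AtomisticToContinuum.BoseEinsteinCondensation.Theorems.LatticeODLROOffHalfFilling.Negative
open scoped ComplexOrder BigOperators

/-! ### The quantitative Kennedy–Lieb–Shastry anchor -/

/-- **Kennedy–Lieb–Shastry, quantitatively** (`d = 3`, `S = ½`, `μ = 0`): if the punctured Riemann sums of the KLS
integrand satisfy `R_L(3) ≤ ρ` for all large `L`, with `0 ≤ ρ < √2/2`, then the `k`-th term of the order parameter of
the crux at `μ = 0` is eventually `≥ ¼ − (√2/4)ρ` (`= 2(s − ½√s ρ)`, `s = ⅛`): the proof of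
`kennedy_lieb_shastry_xy_ground_of_riemannSum_le` with its constant made explicit.
[cite: KLS1988PRL, Theorem, eqs. (5)–(8)] -/
theorem lroSeq_zero_eventually_ge {ρ : ℝ} (hρ0 : 0 ≤ ρ) (hρ : ρ < Real.sqrt 2 / 2)
    (hR : ∀ᶠ L : ℕ in atTop, klsRiemannSum 3 L ≤ ρ) :
    ∀ᶠ k : ℕ in atTop, 1 / 4 - Real.sqrt 2 / 4 * ρ ≤
      (∑ x ∈ halfOpenBox 3 (2 * k), ∑ y ∈ halfOpenBox 3 (2 * k),
        torusPullback (d := 3) (fun L x y => if hL : L = 0 then 0 else (haveI : NeZero L := ⟨hL⟩;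
          (∑ α : Fin 2, (xxzHamiltonian 1 (torusGraph 3 L) (-1) 0 -
            ((0 : ℝ) : ℂ) • totalSpin 1 2).groundStateFunctional
            (siteSpin 1 x (Fin.castSucc α) * siteSpin 1 y (Fin.castSucc α))).re)) (2 * k) x y) /
        ((halfOpenBox 3 (2 * k)).card : ℝ) ^ 2 := by
  -- the tree's form of the LRO sequence
  have htree : ∀ᶠ k : ℕ in atTop, 1 / 4 - Real.sqrt 2 / 4 * ρ ≤
      (∑ x ∈ halfOpenBox 3 (2 * k), ∑ y ∈ halfOpenBox 3 (2 * k),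
        torusPullback (fun L x y => groundStateXYCorrTorus (d := 3) L 1 x y) (2 * k) x y) /
        ((halfOpenBox 3 (2 * k)).card : ℝ) ^ 2 := by
    have hA := kls_xy_infraredBound_ground_holds
    have hB := kubo_xy_bondCorr_abs_le_holds
    have hC := xy_structureFactor_sumRule_holds
    have hD := kls_xy_bondCorr_lower_holds
    have hS := xy_groundCorr_two_eq_one_holds
    set s : ℝ := ((1 : ℝ) / 2) ^ 2 / 2 with hs_def
    have hs0 : 0 ≤ s := by positivity
    have hsq : Real.sqrt s = Real.sqrt 2 / 4 := by
      have h2 : (Real.sqrt 2 / 4) ^ 2 = s := by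
        rw [div_pow, Real.sq_sqrt (by norm_num : (0 : ℝ) ≤ 2), hs_def]
        norm_num
      rw [← h2, Real.sqrt_sq (by positivity)]
    have h2k : Tendsto (fun k : ℕ => 2 * k) atTop atTop :=
      tendsto_atTop_atTop.2 fun b => ⟨b, fun k hk => by omega⟩
    have hRk : ∀ᶠ k : ℕ in atTop, klsRiemannSum 3 (2 * k) ≤ ρ := h2k.eventually hR
    filter_upwards [hRk, eventually_ge_atTop 2] with k hk hk2
    have hn : (1 : ℕ) ≤ 1 := le_rfl
    rw [lroSeq_eq hS 1 k (by omega)]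
    have h7 := kls_ineq7 hA hB hC (by norm_num : 2 ≤ 3) hn hk2
    have hDk : s ≤ xyBondCorr (d := 3) 0 (2 * k) 1 := by
      have := hD 3 (by norm_num) (2 * k) 1 (by omega)
      simpa [hs_def] using this
    have hR0 : 0 ≤ klsRiemannSum 3 (2 * k) := klsRiemannSum_nonneg _ _
    have hss : Real.sqrt 2 / 4 ≤ Real.sqrt s := by rw [hsq]
    have h4s : klsRiemannSum 3 (2 * k) ≤ 4 * Real.sqrt s := by
      have h2pos : (0 : ℝ) < Real.sqrt 2 := by positivity
      rw [hsq]
      linarith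
    have hmono := kls_monotone_step hs0 hDk h4s
    have h1 : s - 1 / 2 * Real.sqrt s * ρ ≤ s - 1 / 2 * Real.sqrt s * klsRiemannSum 3 (2 * k) := by
      nlinarith [Real.sqrt_nonneg s]
    have hc : 1 / 4 - Real.sqrt 2 / 4 * ρ = 2 * (s - 1 / 2 * Real.sqrt s * ρ) := by
      rw [hsq, hs_def]
      ring
    rw [hc]
    linarith
  -- the crux's form is the tree's form (`μ = 0`)
  refine htree.mono fun k hk => ?_
  convert hk using 4
  simp only [groundStateXYCorrTorus, Complex.ofReal_zero, zero_smul, sub_zero]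
  rfl

/-- **The quantitative anchor, column form.** Under `R_L(3) ≤ ρ` eventually (`0 ≤ ρ < √2/2`), for all large `k`
some nonzero column of `P₀(H_{2k,0})` has planar moment `≥ (¼ − (√2/4)ρ)(2k)⁶‖·‖²`.
[cite: KLS1988PRL, Theorem] -/
theorem anchor_of_riemannSum_le {ρ : ℝ} (hρ0 : 0 ≤ ρ) (hρ : ρ < Real.sqrt 2 / 2)
    (hR : ∀ᶠ L : ℕ in atTop, klsRiemannSum 3 L ≤ ρ) :
    ∃ k₀ : ℕ, ∀ k : ℕ, k₀ ≤ k → ∀ [NeZero (2 * k)],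
      ∃ σ, (Hmu (2 * k) 0).groundProj.col σ ≠ 0 ∧
        (1 / 4 - Real.sqrt 2 / 4 * ρ) * (((2 * k : ℕ) : ℝ) ^ 3) ^ 2 *
            (star ((Hmu (2 * k) 0).groundProj.col σ) ⬝ᵥ (Hmu (2 * k) 0).groundProj.col σ).re ≤
          (star ((Hmu (2 * k) 0).groundProj.col σ) ⬝ᵥ
            (∑ x : TorusSite 3 (2 * k), ∑ y : TorusSite 3 (2 * k), hop x y) *ᵥ
              ((Hmu (2 * k) 0).groundProj.col σ)).re := by
  obtain ⟨k₀, hk₀⟩ := eventually_atTop.mp ((lroSeq_zero_eventually_ge hρ0 hρ hR).and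
    (eventually_ge_atTop 2))
  refine ⟨k₀, fun k hk _ => ?_⟩
  obtain ⟨h1, h2⟩ := hk₀ k hk
  rw [orderParam_eq_re_gsf 0 h2] at h1
  have hX : (0 : ℝ) < (((2 * k : ℕ) : ℝ) ^ 3) ^ 2 := by positivity
  rw [le_div_iff₀ hX] at h1
  exact exists_col_quad_ge (Hmu_isHermitian (2 * k) 0) _ _ h1

/-! ### A sharper sector window for `|μ| ≤ 1/10` -/

/-- **Sector window at `|μ| ≤ 1/10`.** Every nonzero `S³_tot`-eigen ground vector of `H_{L,μ}`, `|μ| ≤ 1/10`, `L ≥ 3`,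
has `|M| ≤ (15/58)L³`: `E₀ ≤ −¾L³` (`stub_trialEnergy`), `H_XY ≥ −3(L³/2 − |M|)` on the sector
(`stub_kineticBound`), so `(3 − |μ|)|M| ≤ ¾L³`. [folklore] -/
theorem sector_window_tenth (L : ℕ) [NeZero L] (hL : 3 ≤ L) {μ : ℝ} (hμ : |μ| ≤ 1 / 10) {M : ℝ}
    {v : TensorIndex (TorusSite 3 L) 2 → ℂ} (hv : v ∈ (Hmu L μ).groundSpace)
    (hS : (totalSpin 1 2 : Op (TorusSite 3 L) 2) *ᵥ v = (M : ℂ) • v) (hv0 : v ≠ 0) :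
    |M| ≤ 15 / 58 * (L : ℝ) ^ 3 := by
  have hkin := stub_kineticBound L hL M v hS
  have htrial := stub_trialEnergy L hL μ
  have npos := normSq_pos_of_ne_zero hv0
  set n : ℝ := (star v ⬝ᵥ v).re with hn
  have hE : (star v ⬝ᵥ (Hmu L μ) *ᵥ v).re = (Hmu L μ).groundEnergy * n := by
    rw [(mem_groundSpace_iff _ v).mp hv, dotProduct_smul, smul_eq_mul, Complex.re_ofReal_mul]
  have hsplit : (star v ⬝ᵥ (Hmu L μ) *ᵥ v).re =
      (star v ⬝ᵥ (xyTorus 3 L 1) *ᵥ v).re - μ * M * n := by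
    rw [Hmu, sub_mulVec, smul_mulVec, hS, smul_smul, dotProduct_sub, dotProduct_smul,
      smul_eq_mul, Complex.sub_re, ← Complex.ofReal_mul, Complex.re_ofReal_mul]
  have h1 : (Hmu L μ).groundEnergy * n ≤ -(3 / 4 * (L : ℝ) ^ 3) * n :=
    mul_le_mul_of_nonneg_right htrial npos.le
  have hC : μ * M * n ≤ |μ| * |M| * n := by
    rw [← abs_mul]
    exact mul_le_mul_of_nonneg_right (le_abs_self _) npos.le
  have e1 : -(3 * ((L : ℝ) ^ 3 / 2 - |M|)) * n = -(3 / 2) * ((L : ℝ) ^ 3 * n) + 3 * (|M| * n) := by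
    ring
  have e2 : -(3 / 4 * (L : ℝ) ^ 3) * n = -(3 / 4) * ((L : ℝ) ^ 3 * n) := by ring
  have e3 : |μ| * |M| * n = |μ| * (|M| * n) := by ring
  rw [e1] at hkin
  rw [e2] at h1
  rw [e3] at hC
  have hMn : (29 / 10 : ℝ) * (|M| * n) ≤ 3 / 4 * ((L : ℝ) ^ 3 * n) := by
    have hμ2 : |μ| * (|M| * n) ≤ 1 / 10 * (|M| * n) :=
      mul_le_mul_of_nonneg_right hμ (mul_nonneg (abs_nonneg M) npos.le)
    linarith
  have hfin : (29 / 10 : ℝ) * |M| * n ≤ 3 / 4 * (L : ℝ) ^ 3 * n := by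
    have e4 : (29 / 10 : ℝ) * |M| * n = 29 / 10 * (|M| * n) := by ring
    have e5 : 3 / 4 * (L : ℝ) ^ 3 * n = 3 / 4 * ((L : ℝ) ^ 3 * n) := by ring
    rw [e4, e5]
    exact hMn
  have key' : (29 / 10 : ℝ) * |M| ≤ 3 / 4 * (L : ℝ) ^ 3 := le_of_mul_le_mul_right hfin npos
  linarith

/-! ### Casimir monotonicity ⇒ the crux (modulo the certified Riemann-sum bound) -/

/-- **Casimir monotonicity of the sector ground states implies ODLRO off half filling**, given the certified
numerical input `R_L(3) ≤ ½` for all large `L` (the KLS Riemann sums; `lim R_L(3) = I(3) = 0.3499`). Hypothesis `hCS`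
(the weakest ladder shape, implied by MONO): on large even tori, for every filling `1 ≤ N ≤ L³ − 1`, the sector ground
vector `ψ` with `N` particles and the half-filled one `ψh` satisfy `⟨S_tot²⟩_ψ ≥ ⟨S_tot²⟩_{ψh}`, i.e.
`a(ψh) ≤ a(ψ) + (N − L³/2)²` with `a(φ) = Re⟨φ, Oφ⟩/‖φ‖²`, `O = Σ_{x,y}(S¹_xS¹_y+S²_xS²_y) = S_tot² − (S³_tot)²`.
Conclusion with `μ₀ = 1/10` and liminf bound `¼ − √2/8 − (15/58)² > 0.006`: GroundSectorUnique puts the quantitative KLS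
anchor at half filling, `sector_window_tenth` bounds `M²`, `stub_average` averages over the columns of `P₀`. [folklore] -/
theorem LatticeODLROOffHalfFilling_of_casimir
    (hCS : ∃ L₀ : ℕ, ∀ (L : ℕ) [NeZero L], L₀ ≤ L → Even L → ∀ N : ℕ, 1 ≤ N → N + 1 ≤ L ^ 3 →
      ∀ ψ ψh : TensorIndex (TorusSite 3 L) 2 → ℂ,
        ψ ≠ 0 → (totalSpin 1 2 : Op (TorusSite 3 L) 2) *ᵥ ψ =
            ((((N : ℝ) - (L : ℝ) ^ 3 / 2 : ℝ)) : ℂ) • ψ →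
          xyTorus 3 L 1 *ᵥ ψ = ((lowestEnergyInSector 1 (xyTorus 3 L 1)
            ((N : ℝ) - (L : ℝ) ^ 3 / 2) : ℝ) : ℂ) • ψ →
        ψh ≠ 0 → (totalSpin 1 2 : Op (TorusSite 3 L) 2) *ᵥ ψh = ((0 : ℝ) : ℂ) • ψh →
          xyTorus 3 L 1 *ᵥ ψh = ((lowestEnergyInSector 1 (xyTorus 3 L 1) 0 : ℝ) : ℂ) • ψh →
        (star ψh ⬝ᵥ (∑ x : TorusSite 3 L, ∑ y : TorusSite 3 L, hop x y) *ᵥ ψh).re /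
            (star ψh ⬝ᵥ ψh).re ≤
          (star ψ ⬝ᵥ (∑ x : TorusSite 3 L, ∑ y : TorusSite 3 L, hop x y) *ᵥ ψ).re /
            (star ψ ⬝ᵥ ψ).re + ((N : ℝ) - (L : ℝ) ^ 3 / 2) ^ 2)
    (hρ : ∀ᶠ L : ℕ in atTop, klsRiemannSum 3 L ≤ 1 / 2) :
    Summit.AtomisticToContinuum.BoseEinsteinCondensation.Theses.BECGroundStateSOS.LatticeODLROOffHalfFilling := by
  rw [latticeODLRO_iff]
  obtain ⟨L₁, hcs⟩ := hCS
  have hρlt : (1 / 2 : ℝ) < Real.sqrt 2 / 2 := by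
    have : (1 : ℝ) < Real.sqrt 2 := by
      rw [show (1 : ℝ) = Real.sqrt 1 by simp]
      exact Real.sqrt_lt_sqrt (by norm_num) (by norm_num)
    linarith
  obtain ⟨k₀, hanchor⟩ := anchor_of_riemannSum_le (by norm_num : (0 : ℝ) ≤ 1 / 2) hρlt hρ
  -- the constants: `a₀ = ¼ − √2/8`, window `(15/58)²`, `c' = a₀ − (15/58)² > 0`
  set a₀ : ℝ := 1 / 4 - Real.sqrt 2 / 4 * (1 / 2) with ha₀
  set c' : ℝ := a₀ - (15 / 58) ^ 2 with hc'
  have hsqrt2 : Real.sqrt 2 < 1.415 := by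
    rw [Real.sqrt_lt' (by norm_num)]
    norm_num
  have hc'pos : 0 < c' := by
    rw [hc', ha₀]
    nlinarith
  refine ⟨1 / 10, by norm_num, fun μ hμ => ?_⟩
  have hμ' : |μ| ≤ 1 / 10 := hμ.le
  unfold LROAt
  set f : ℕ → ℝ := fun k : ℕ => (∑ x ∈ halfOpenBox 3 (2 * k), ∑ y ∈ halfOpenBox 3 (2 * k),
    torusPullback (d := 3) (fun L x y => if hL : L = 0 then 0 else (haveI : NeZero L := ⟨hL⟩;
      (∑ α : Fin 2, (xxzHamiltonian 1 (torusGraph 3 L) (-1) 0 -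
        (μ : ℂ) • totalSpin 1 2).groundStateFunctional
        (siteSpin 1 x (Fin.castSucc α) * siteSpin 1 y (Fin.castSucc α))).re)) (2 * k) x y) /
      ((halfOpenBox 3 (2 * k)).card : ℝ) ^ 2 with hf
  have hbd : ∀ k, f k ≤ 1 / 2 := fun k => orderParam_le_half μ k
  suffices hev : ∀ᶠ k : ℕ in Filter.atTop, c' ≤ f k from
    hc'pos.trans_le (Filter.le_liminf_of_le (Filter.isCoboundedUnder_ge_of_le Filter.atTop hbd) hev)
  filter_upwards [Filter.eventually_ge_atTop (max k₀ (max 2 L₁))] with k hk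
  have hkk₀ : k₀ ≤ k := le_trans (le_max_left _ _) hk
  have hk2 : 2 ≤ k := le_trans (le_trans (le_max_left _ _) (le_max_right _ _)) hk
  have hkL₁ : L₁ ≤ 2 * k :=
    (le_trans (le_trans (le_max_right _ _) (le_max_right _ _)) hk).trans (by omega)
  have hL0 : 2 * k ≠ 0 := by omega
  haveI : NeZero (2 * k) := ⟨hL0⟩
  have hL3 : 3 ≤ 2 * k := by omega
  have hL4 : 4 ≤ 2 * k := by omega
  have hEven : Even (2 * k) := even_two_mul k
  set L : ℕ := 2 * k with hLdef
  set V : ℝ := (L : ℝ) ^ 3 with hVdef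
  have hVpos : 0 < V := by positivity
  have h64 : (64 : ℝ) ≤ V := by
    have h4 : (4 : ℝ) ≤ (L : ℝ) := by exact_mod_cast hL4
    have h := pow_le_pow_left₀ (by norm_num) h4 3
    rw [hVdef]
    norm_num at h ⊢
    exact h
  set O : Op (TorusSite 3 L) 2 := ∑ x : TorusSite 3 L, ∑ y : TorusSite 3 L, hop x y with hO
  -- the anchor at `μ = 0`: half filled (GroundSectorUnique) and a sector ground vector
  obtain ⟨σ', hσ'0, hσ'⟩ := hanchor k hkk₀
  set v' := (Hmu L 0).groundProj.col σ' with hv'def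
  obtain ⟨hv'mem, -⟩ := col_facts L hL3 0 σ'
  have hS' : (totalSpin 1 2 : Op (TorusSite 3 L) 2) *ᵥ v' = ((0 : ℝ) : ℂ) • v' := by
    rw [Complex.ofReal_zero, zero_smul]
    exact groundSector_zero L hL4 hEven v' hv'mem
  have hH' : xyTorus 3 L 1 *ᵥ v' = ((lowestEnergyInSector 1 (xyTorus 3 L 1) 0 : ℝ) : ℂ) • v' :=
    stub_sectorGround L 0 0 v' hv'mem hS' hσ'0
  have n'pos := normSq_pos_of_ne_zero hσ'0
  have hcast : (((2 * k : ℕ) : ℝ) ^ 3) = V := by rw [hVdef]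
  rw [hcast] at hσ'
  have hratio' : a₀ * V ^ 2 ≤ (star v' ⬝ᵥ O *ᵥ v').re / (star v' ⬝ᵥ v').re := by
    rw [le_div_iff₀ n'pos]
    exact hσ'
  -- the k-th term
  show c' ≤ f k
  rw [hf]
  simp only []
  rw [orderParam_eq_re_gsf μ hk2]
  rw [le_div_iff₀ (by positivity)]
  rw [hcast]
  refine stub_average (Hmu_isHermitian L μ) O (c' * V ^ 2) fun σ hσ0 => ?_
  set v := (Hmu L μ).groundProj.col σ with hvdef
  obtain ⟨hvmem, hS3⟩ := col_facts L hL3 μ σ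
  set M : ℝ := (L : ℝ) ^ 3 / 2 - (downCount σ : ℝ) with hM
  have hwin := sector_window_tenth L hL3 hμ' hvmem hS3 hσ0
  have npos := normSq_pos_of_ne_zero hσ0
  have hj : downCount σ ≤ L ^ 3 := by
    have h1 : downCount σ ≤ Fintype.card (TorusSite 3 L) := Finset.card_filter_le _ _ |>.trans
      (by rw [Finset.card_univ])
    have h2 : Fintype.card (TorusSite 3 L) = L ^ 3 := by simp [ZMod.card, Fintype.card_fin]
    omega
  set N : ℕ := L ^ 3 - downCount σ with hNdef
  have hMeq : ((N : ℕ) : ℝ) - (L : ℝ) ^ 3 / 2 = M := by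
    rw [hNdef, Nat.cast_sub hj]
    push_cast
    rw [hM]
    ring
  have hN1 : 1 ≤ N := by
    have hlo : (1 : ℝ) ≤ ((N : ℕ) : ℝ) := by
      rw [hNdef, Nat.cast_sub hj]
      push_cast
      rw [abs_le] at hwin
      obtain ⟨hw1, hw2⟩ := hwin
      rw [hM, ← hVdef] at hw1 hw2
      rw [← hVdef]
      linarith
    exact_mod_cast hlo
  have hN2 : N + 1 ≤ L ^ 3 := by
    have hhi : ((N : ℕ) : ℝ) + 1 ≤ (L : ℝ) ^ 3 := by
      rw [hNdef, Nat.cast_sub hj]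
      push_cast
      rw [abs_le] at hwin
      obtain ⟨hw1, hw2⟩ := hwin
      rw [hM, ← hVdef] at hw1 hw2
      rw [← hVdef]
      linarith
    exact_mod_cast hhi
  have hS : (totalSpin 1 2 : Op (TorusSite 3 L) 2) *ᵥ v = ((((N : ℝ) - (L : ℝ) ^ 3 / 2 : ℝ)) : ℂ) • v := by
    rw [hMeq]
    exact hS3
  have hH : xyTorus 3 L 1 *ᵥ v = ((lowestEnergyInSector 1 (xyTorus 3 L 1)
      ((N : ℝ) - (L : ℝ) ^ 3 / 2) : ℝ) : ℂ) • v := by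
    rw [hMeq]
    exact stub_sectorGround L μ M v hvmem hS3 hσ0
  have key := hcs L hkL₁ hEven N hN1 hN2 v v' hσ0 hS hH hσ'0 hS' hH'
  rw [hMeq] at key
  -- `M² ≤ (15/58)² V²`
  have hM2 : M ^ 2 ≤ (15 / 58) ^ 2 * V ^ 2 := by
    rw [← hVdef] at hwin
    have hMabs : |M| ^ 2 ≤ (15 / 58 * V) ^ 2 := pow_le_pow_left₀ (abs_nonneg M) hwin 2
    rw [sq_abs] at hMabs
    nlinarith
  have hratio : (star v ⬝ᵥ O *ᵥ v).re / (star v ⬝ᵥ v).re * (star v ⬝ᵥ v).re =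
      (star v ⬝ᵥ O *ᵥ v).re := div_mul_cancel₀ _ npos.ne'
  have hmain : c' * V ^ 2 ≤ (star v ⬝ᵥ O *ᵥ v).re / (star v ⬝ᵥ v).re := by
    rw [hc']
    linarith [key, hratio', hM2]
  calc c' * V ^ 2 * (star v ⬝ᵥ v).re
      ≤ (star v ⬝ᵥ O *ᵥ v).re / (star v ⬝ᵥ v).re * (star v ⬝ᵥ v).re :=
        mul_le_mul_of_nonneg_right hmain npos.le
    _ = (star v ⬝ᵥ O *ᵥ v).re := hratio

end Summit.AtomisticToContinuum.BoseEinsteinCondensation.Theorems.LatticeODLROOffHalfFilling.Ladder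

end
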